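import Summits.KontsevichZagierPeriods.KontsevichZagierPeriods.Theorems.LinRedNormalFormArrangementNormalFormStubRebaseSimpleZeroManyChainTools

/-!
# Stub `stub_rebaseSimpleZeroMany`, part `rebaseSimpleZeroMany_common` (crux `ArrangementNormalForm`,
line `janus-bands`) — brick `ChainBlowMap`

Calculus of the PINCH-VERTEX BLOW-UP of `k` fibres over a one-dimensional base in the `Z`-chart
`Ψ(Z, a) = (y₀ + ε₁ Z, (t₀ + aₗ Z)ₗ)` (new base `Z = |y − y₀|`, new fibres the slopes
`aₗ = (tₗ − t₀)/|y − y₀|`): `RebaseChain.zmap` is a polynomial, hence `ℚ`-semialgebraic, map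
(`isSemialgebraicMapOn_zmap`), with the explicit block-triangular Jacobian `RebaseChain.zmat`
(`hasFDerivAt_zmap`) of determinant `ε₁ Z^k` (`zmat_det`, `zlin_det`), injective off `Z = 0`
(`zmap_injOn`), with the explicit inverse `RebaseChain.zinv` (`zmap_zinv`). In this chart every
affine bound THROUGH the vertex `(y₀, t₀)` becomes a constant bound and every pole AT the vertex
level `t₀` becomes the constant letter `1/(aₗ Z)`. Registered: `rebaseSimpleZeroMany_zmapDet`.

References: M. Kontsevich, D. Zagier, *Periods* (2001), §1.2, rule (2).
-/

noncomputable section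

open Set MeasureTheory MvPolynomial
open Literature.NumberTheory.Transcendental Literature.ModelTheory.ExponentialFields

namespace Summit.KontsevichZagierPeriods.ArrangementNormalForm.JanusBands

namespace RebaseChain

open SeparatePos RebasePos RebaseZero

variable {k : ℕ}

/-! ### The chart -/

/-- The `Z`-chart `Ψ(Z, a) = (y₀ + ε₁ Z, (t₀ + aₗ Z)ₗ)` of the pinch-vertex blow-up. -/
def zmap (ε₁ y₀ t₀ : ℝ) (w : Fin (0 + 1 + k) → ℝ) : Fin (0 + 1 + k) → ℝ :=
  Fin.append (fun _ : Fin (0 + 1) => y₀ + ε₁ * yv w) (fun l => t₀ + tv w l * yv w)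

variable (ε₁ y₀ t₀ : ℝ)

/-- The chart on the base coordinate. -/
@[simp] theorem zmap_castAdd (w : Fin (0 + 1 + k) → ℝ) (j : Fin (0 + 1)) :
    zmap ε₁ y₀ t₀ w (Fin.castAdd k j) = y₀ + ε₁ * yv w := by
  simp [zmap]

/-- The chart on the fibre coordinates. -/
@[simp] theorem zmap_natAdd (w : Fin (0 + 1 + k) → ℝ) (l : Fin k) :
    zmap ε₁ y₀ t₀ w (Fin.natAdd (0 + 1) l) = t₀ + tv w l * yv w := by
  simp [zmap]

/-- The new base coordinate is the rescaled distance to `y₀`. -/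
@[simp] theorem yv_zmap (w : Fin (0 + 1 + k) → ℝ) : yv (zmap ε₁ y₀ t₀ w) = y₀ + ε₁ * yv w :=
  zmap_castAdd ε₁ y₀ t₀ w _

/-- The fibres of the chart. -/
@[simp] theorem tv_zmap (w : Fin (0 + 1 + k) → ℝ) (l : Fin k) :
    tv (zmap ε₁ y₀ t₀ w) l = t₀ + tv w l * yv w :=
  zmap_natAdd ε₁ y₀ t₀ w l

/-! ### The Jacobian -/

/-- The Jacobian matrix `[[ε₁, 0], [a, Z·1]]` of the chart at `w = (Z, a)`. -/
def zmat (w : Fin (0 + 1 + k) → ℝ) : Matrix (Fin (0 + 1 + k)) (Fin (0 + 1 + k)) ℝ :=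
  (Matrix.fromBlocks (ε₁ • (1 : Matrix (Fin (0 + 1)) (Fin (0 + 1)) ℝ)) 0
    (fun l _ => tv w l) (Matrix.diagonal fun _ => yv w)).reindex finSumFinEquiv finSumFinEquiv

/-- The Jacobian matrix in coordinates. -/
theorem zmat_mulVec (w v : Fin (0 + 1 + k) → ℝ) :
    (zmat ε₁ w).mulVec v = Fin.append (fun _ : Fin (0 + 1) => ε₁ * yv v)
      (fun l => tv w l * yv v + yv w * tv v l) := by
  ext i
  refine Fin.addCases (fun j => ?_) (fun l => ?_) i
  · rw [RebaseZero.eq_last j]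
    simp [zmat, Matrix.mulVec, dotProduct, Fin.sum_univ_add, Matrix.fromBlocks_apply₁₁,
      Matrix.fromBlocks_apply₁₂, Matrix.one_apply, yv, yIdx]
  · simp [zmat, Matrix.mulVec, dotProduct, Fin.sum_univ_add, Matrix.fromBlocks_apply₂₁,
      Matrix.fromBlocks_apply₂₂, Matrix.diagonal_apply, yv, yIdx, tv, tIdx]

/-- The Jacobian determinant is `ε₁ Z^k`. -/
theorem zmat_det (w : Fin (0 + 1 + k) → ℝ) : (zmat ε₁ w).det = ε₁ * yv w ^ k := by
  rw [zmat, Matrix.det_reindex_self, Matrix.det_fromBlocks_zero₁₂, Matrix.det_smul, Matrix.det_one,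
    Matrix.det_diagonal, Finset.prod_const, Finset.card_univ, Fintype.card_fin, Fintype.card_fin]
  ring

/-- The Jacobian as a continuous linear map. -/
def zlin (w : Fin (0 + 1 + k) → ℝ) : (Fin (0 + 1 + k) → ℝ) →L[ℝ] (Fin (0 + 1 + k) → ℝ) :=
  LinearMap.toContinuousLinearMap (Matrix.toLin' (zmat ε₁ w))

/-- The Jacobian in coordinates. -/
theorem zlin_apply (w v : Fin (0 + 1 + k) → ℝ) :
    zlin ε₁ w v = Fin.append (fun _ : Fin (0 + 1) => ε₁ * yv v)
      (fun l => tv w l * yv v + yv w * tv v l) := by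
  rw [zlin, LinearMap.coe_toContinuousLinearMap', Matrix.toLin'_apply, zmat_mulVec]

/-- The determinant of the Jacobian. -/
theorem zlin_det (w : Fin (0 + 1 + k) → ℝ) : (zlin ε₁ w).det = ε₁ * yv w ^ k := by
  rw [zlin, ContinuousLinearMap.det, LinearMap.coe_toContinuousLinearMap, LinearMap.det_toLin',
    zmat_det]

/-- **The chart is differentiable** with derivative `zlin`. -/
theorem hasFDerivAt_zmap (w : Fin (0 + 1 + k) → ℝ) :
    HasFDerivAt (zmap ε₁ y₀ t₀) (zlin ε₁ w) w := by
  rw [hasFDerivAt_pi']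
  have hy : HasFDerivAt (fun v : Fin (0 + 1 + k) → ℝ => v (yIdx k))
      (ContinuousLinearMap.proj (R := ℝ) (φ := fun _ : Fin (0 + 1 + k) => ℝ) (yIdx k)) w :=
    hasFDerivAt_apply (yIdx k) w
  refine Fin.addCases (fun j => ?_) (fun l => ?_)
  · have h1 : HasFDerivAt (fun v : Fin (0 + 1 + k) → ℝ => y₀ + ε₁ * v (yIdx k))
        (ε₁ • ContinuousLinearMap.proj (R := ℝ) (φ := fun _ : Fin (0 + 1 + k) => ℝ) (yIdx k)) w :=
      (hy.const_mul ε₁).const_add y₀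
    refine (h1.congr_fderiv ?_).congr_of_eventuallyEq (Filter.Eventually.of_forall fun v => ?_)
    · ext v
      simp [zlin_apply, yv]
    · simp [zmap, yv]
  · have ht : HasFDerivAt (fun v : Fin (0 + 1 + k) → ℝ => v (tIdx l))
        (ContinuousLinearMap.proj (R := ℝ) (φ := fun _ : Fin (0 + 1 + k) => ℝ) (tIdx l)) w :=
      hasFDerivAt_apply (tIdx l) w
    have h1 : HasFDerivAt (fun v : Fin (0 + 1 + k) → ℝ => t₀ + v (tIdx l) * v (yIdx k))
        (w (tIdx l) • ContinuousLinearMap.proj (R := ℝ) (φ := fun _ : Fin (0 + 1 + k) => ℝ) (yIdx k) +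
          w (yIdx k) • ContinuousLinearMap.proj (R := ℝ) (φ := fun _ : Fin (0 + 1 + k) => ℝ) (tIdx l)) w :=
      (ht.mul hy).const_add t₀
    refine (h1.congr_fderiv ?_).congr_of_eventuallyEq (Filter.Eventually.of_forall fun v => ?_)
    · ext v
      simp [zlin_apply, yv, tv]
    · simp [zmap, yv, tv]

/-! ### Injectivity, inverse, semialgebraicity -/

/-- The inverse chart: `Z = ε₁ (y − y₀)`, `aₗ = (tₗ − t₀)/Z`. -/
def zinv (z : Fin (0 + 1 + k) → ℝ) : Fin (0 + 1 + k) → ℝ :=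
  Fin.append (fun _ : Fin (0 + 1) => ε₁ * (yv z - y₀)) (fun l => (tv z l - t₀) / (ε₁ * (yv z - y₀)))

/-- The new base coordinate of the inverse chart. -/
@[simp] theorem yv_zinv (z : Fin (0 + 1 + k) → ℝ) : yv (zinv ε₁ y₀ t₀ z) = ε₁ * (yv z - y₀) := by
  simp [zinv, yv, yIdx]

/-- The new fibres of the inverse chart. -/
@[simp] theorem tv_zinv (z : Fin (0 + 1 + k) → ℝ) (l : Fin k) :
    tv (zinv ε₁ y₀ t₀ z) l = (tv z l - t₀) / (ε₁ * (yv z - y₀)) := by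
  simp [zinv, tv, tIdx]

/-- Every point is determined by its base and fibre coordinates. [folklore] -/
theorem ext_yv_tv {z z' : Fin (0 + 1 + k) → ℝ} (hy : yv z = yv z') (ht : ∀ l, tv z l = tv z' l) :
    z = z' := by
  funext i
  rcases idx_cases i with rfl | ⟨l, rfl⟩
  · exact hy
  · exact ht l

/-- `Ψ ∘ Ψ⁻¹ = id` off the wall `y = y₀` (`ε₁ = ±1`). -/
theorem zmap_zinv (hε : ε₁ * ε₁ = 1) {z : Fin (0 + 1 + k) → ℝ} (hz : yv z ≠ y₀) :
    zmap ε₁ y₀ t₀ (zinv ε₁ y₀ t₀ z) = z := by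
  have hne : ε₁ * (yv z - y₀) ≠ 0 := mul_ne_zero (fun h0 => by rw [h0, mul_zero] at hε; exact zero_ne_one hε)
    (sub_ne_zero.2 hz)
  refine ext_yv_tv (by rw [yv_zmap, yv_zinv]; linear_combination (yv z - y₀) * hε) fun l => ?_
  rw [tv_zmap, tv_zinv, yv_zinv, div_mul_cancel₀ _ hne]
  ring

/-- **The chart is injective** off `Z = 0` (`ε₁ ≠ 0`). -/
theorem zmap_injOn (hε : ε₁ ≠ 0) {R : Set (Fin (0 + 1 + k) → ℝ)} (hR : ∀ w ∈ R, yv w ≠ 0) :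
    InjOn (zmap ε₁ y₀ t₀) R := by
  intro w hw w' _ h
  have hy : yv w = yv w' := by
    have := congrArg yv h
    rw [yv_zmap, yv_zmap] at this
    exact mul_left_cancel₀ hε (by linarith)
  refine ext_yv_tv hy fun l => ?_
  have := congrArg (fun z => tv z l) h
  simp only [tv_zmap, ← hy] at this
  exact mul_right_cancel₀ (hR w hw) (by linarith)

/-- **The chart with rational data is a semialgebraic map** (it is polynomial). -/
theorem isSemialgebraicMapOn_zmap (ε₁ y₀ t₀ : ℚ) {R : Set (Fin (0 + 1 + k) → ℝ)} (hR : IsSemialgebraic ℚ R) :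
    IsSemialgebraicMapOn ℚ R (zmap (ε₁ : ℝ) y₀ t₀) := by
  refine (isSemialgebraicMapOn_aeval hR (Fin.append
    (fun _ : Fin (0 + 1) => MvPolynomial.C y₀ + MvPolynomial.C ε₁ * X (yIdx k))
    (fun l => MvPolynomial.C t₀ + X (tIdx l) * X (yIdx k)))).congr fun w _ => ?_
  funext i
  refine Fin.addCases (fun j => ?_) (fun l => ?_) i
  · simp [zmap, yv]
  · simp [zmap, yv, tv]

end RebaseChain

/-- Registered support goal of this file (part of `rebaseSimpleZeroMany_common`): the Jacobian
determinant of the `Z`-chart of the pinch-vertex blow-up (`RebaseChain.zlin_det`). -/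
theorem rebaseSimpleZeroMany_zmapDet (k : ℕ) (ε₁ : ℝ) (w : Fin (0 + 1 + k) → ℝ) : (RebaseChain.zlin ε₁ w).det = ε₁ * RebaseZero.yv w ^ k :=
  RebaseChain.zlin_det ε₁ w

end Summit.KontsevichZagierPeriods.ArrangementNormalForm.JanusBands
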